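import Summits.BirchSwinnertonDyer.Rank1Residual.X11b.Three.KolyvaginClassBadPlaceEnd
import Summits.BirchSwinnertonDyer.Rank1Residual.X11b.Three.UnramifiedClassNode
import HarnessLib

/-!
# X11b at `p = 3` (team N8/O2), S15 (iii)(b/c) consumer: Gross 1991 Prop. 6.2 (1) for Kolyvagin's
# point at a place of MULTIPLICATIVE reduction, the binder `hvanish` DISCHARGED for `B ⊆ E₀`

HONEST FRAMING (cell `b2b-bsdres`, run/shared/lean/b2b/bsd-rank1-residual/, verbatim in every
file): the goal of the cell is to DELETE the COMBINATION-SHAPED residual classes of the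
Birch–Swinnerton-Dyer formula for ALL analytic-rank `≤ 1` elliptic curves over `ℚ` — "full BSD
formula for every rank `≤ 1` curve in class `C`" assembled STRICTLY from published theorems — so
that the rank-`≤ 1` remainder becomes exactly the CONSTRUCTION-SHAPED classes, which are TYPED
(missing-input `Prop`s), NOT attempted. This is not "finishing BSD". Team N8/O2 = `x11b3`, seat
`b2b-bsdres-x11b3-p8` (GEN 3), LEAD DEAL #7 R7-16a (3): "when (3) lands, a ≤ 40-line consumer
corollary discharges the binder". LABEL OF RECORD: flag-discharge hygiene for `JET@p|N` (harvest
E66 (D)) — NOT count-moving; nothing is booked; `O2` OPEN. THEOREMS ONLY: no definition, no named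
fact, no `sorry`.

## What

x11b3-p1's END FORM `GrossBadPlace.kolyvaginClass_kolyvaginPoint_mem_selmerLocalKer_of_GZ31`
(p254200: Gross 1991 Prop. 6.2 (1) for `P_n`, with the binders `hGZ31` = [GZ86, III (3.1)] and
`hvanish` = (α) for the receptacle `B`) at a place `v` of MULTIPLICATIVE reduction of `E`, with
`hvanish` DISCHARGED by the cell's `UnramifiedNode.oneCocycleClass_eq_zero_of_hasMultiplicativeReductionAt`
(Milne *ADT* I.3.8 for `E₀` at a node, S15 (iii)(b/c)) for every `B` contained in `E₀(K̄_v)` — the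
points with nonsingular reduction on the minimal model at `v`, read through the tree's transport
`Φ` (variable change `C` to the minimal model, `𝒪_w`-model along `ι : 𝓞_v → 𝒪_w`, spectral
valuation `w`; the tree's existential witnesses, taken as parameters).

HONEST CONSEQUENCE (LEAD R7-16a (3)): what is carried is exactly `hGZ31` (whose last clause now
says "`n′ • (jx)_v ∈ B ⊆ E₀`", the published [GZ86, III (3.1)] "`y_n ∈ E⁰ + E(ℚ)_tors` at every
`w ∣ N`", Gross 1991 p. 245) + the Euler-system data; the `c_v` / component-group content of
Jetchev 2008 Prop. 4.1 at `v ∣ p` lives entirely in that binder. `JET@p|N` is NOT discharged;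
nothing is booked.

References (locators only; no cited FACT): [cite: GrossLMS1991, Prop. 6.2 (1), pp. 244–245]
[cite: GrossZagier1986, III (3.1)] [cite: MilneADT2006, Ch. I Prop. 3.8]; cell files p254200
(p1), `UnramifiedClassNode` (p8).
-/

noncomputable section

open scoped Classical NNReal
open scoped AddSubgroup

namespace Summit.BirchSwinnertonDyer.Rank1Residual.X11b.Three.UnramifiedNode

open WeierstrassCurve NumberField IsDedekindDomain Field
  Literature.NumberTheory.EllipticCurves Literature.NumberTheory.EllipticCurves.KolyvaginCocycle
  Literature.NumberTheory.EllipticCurves.KolyvaginEuler Literature.NumberTheory.GaloisRepresentations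
  Summit.BirchSwinnertonDyer.Rank1Residual.X11b.Three.KolyvaginRoot
  Summit.BirchSwinnertonDyer.Rank1Residual.X11b.Three.GrossBadPlace IsDedekindDomain.HeightOneSpectrum

universe u

variable {K : Type u} [Field K] [NumberField K] (W : WeierstrassCurve K) {n : ℤ}
variable {hdiv : ∀ P : geomPoints W, ∃ Q : geomPoints W, n • Q = P}
variable {𝒢 : Type*} [CommGroup 𝒢] {A₀ : Type*} [AddCommGroup A₀] [DistribMulAction 𝒢 A₀]

/-- **Gross 1991, Prop. 6.2 (1) for Kolyvagin's point `P_n` at a place of MULTIPLICATIVE reduction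
of `E`, with (α) PROVED**: x11b3-p1's END FORM with its hypothesis `hvanish` discharged by Milne
*ADT* I.3.8 for `E₀` at a node (`oneCocycleClass_eq_zero_of_hasMultiplicativeReductionAt`), for any
receptacle `B ≤ E(K̄_v)` whose points have nonsingular reduction on the minimal model at `v`
(hypothesis `hB`, read through the tree's transport determined by `C`, `ι`, `w`). Carried: the
Euler-system data, admissibility, inertia fixing `jP_n`, and `hGZ31` ([GZ86, III (3.1)] via Gross
p. 245, cite-only) — where all component-group content lives; `JET@p|N` is NOT discharged.
[cite: GrossLMS1991, Prop. 6.2 (1), pp. 244–245] [cite: GrossZagier1986, III (3.1)]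
[cite: MilneADT2006, Ch. I Prop. 3.8] -/
theorem kolyvaginClass_kolyvaginPoint_mem_selmerLocalKer_of_GZ31_of_hasMultiplicativeReductionAt
    [W.IsElliptic]
    {σ : ℕ → 𝒢} {L : Finset ℕ} {H : Subgroup 𝒢} [Fintype (𝒢 ⧸ H)] {f : 𝒢 ⧸ H → 𝒢}
    (hf : ∀ q, (f q : 𝒢 ⧸ H) = q) (hgen : H ≤ Subgroup.closure (σ '' (L : Set ℕ)))
    (hord : ∀ ℓ ∈ L, σ ℓ ^ (ℓ + 1) = 1) (hdvd : ∀ ℓ ∈ L, n ∣ ((ℓ + 1 : ℕ) : ℤ)) {y : A₀}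
    (π : absoluteGaloisGroup K →* 𝒢) (j : A₀ →+ geomPoints W)
    (hj : ∀ (g : absoluteGaloisGroup K) (a : A₀), j (π g • a) = g • j a)
    (hA : IsAdmissible (absoluteGaloisGroup K) j.range n)
    (hP : j (kolyvaginPoint σ L f y) ∈ invPoints (absoluteGaloisGroup K) j.range n)
    -- the place: multiplicative reduction
    (v : HeightOneSpectrum (𝓞 K)) (hmult : W.HasMultiplicativeReductionAt v)
    {𝔐 : Ideal (v.localAbsIntegers)} (h𝔐 : 𝔐 ∈ v.localPrimesAbove)
    (hI : ∀ τ ∈ 𝔐.inertia (absoluteGaloisGroup (v.adicCompletion K)),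
      resGal (K := K) (v.adicCompletion K) τ • j (kolyvaginPoint σ L f y) =
        j (kolyvaginPoint σ L f y))
    -- the transport data (tree witnesses) and the receptacle `B ⊆ E₀`
    {w : Valuation (AlgebraicClosure (v.adicCompletion K)) ℝ≥0}
    (hw : ∀ x, (w x : ℝ) = spectralNorm (v.adicCompletion K) (AlgebraicClosure (v.adicCompletion K)) x)
    {ι : v.adicCompletionIntegers K →+* w.integer}
    (hι : ∀ a, ((ι a : w.integer) : AlgebraicClosure (v.adicCompletion K)) =
      algebraMap (v.adicCompletion K) (AlgebraicClosure (v.adicCompletion K)) (a : v.adicCompletion K))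
    {C : VariableChange (v.adicCompletion K)}
    (hC : C • W.baseChange (v.adicCompletion K) =
      (W.localMinimalIntegralModel v).map (algebraMap (v.adicCompletionIntegers K) (v.adicCompletion K)))
    {E' : AddSubgroup A₀} (B : AddSubgroup (localPoints W (v.adicCompletion K))) {n' : ℤ}
    (hB : ∀ Q ∈ B, ((W.localMinimalIntegralModel v).map ι).HasNonsingularReduction
      (Affine.Point.congrEquiv (baseChange_map_eq_baseChange_map hι (W.localMinimalIntegralModel v))
        (Affine.Point.congrEquiv (congrArg (fun X : WeierstrassCurve (v.adicCompletion K) ↦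
            X.baseChange (AlgebraicClosure (v.adicCompletion K))) hC)
          (VariableChange.pointEquivBaseChange (W.baseChange (v.adicCompletion K)) C
            (AlgebraicClosure (v.adicCompletion K))
            (Affine.Point.congrEquiv (baseChange_baseChange_adicCompletion W v).symm Q)))))
    -- hGZ31 (= [GZ86, III (3.1)] via Gross 1991 p. 245; cite-only)
    (hGZ31 : (∀ (γ : 𝒢), ∀ e ∈ E', γ • e ∈ E') ∧ y ∈ E' ∧
      (∀ ℓ ∈ L, grAct A₀ (traceElt (σ ℓ) ℓ) y ∈ E'.map (zsmulAddGroupHom n : A₀ →+ A₀)) ∧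
      ∀ x ∈ E', n' • pointsMap W (v.adicCompletion K) (j x) ∈ B)
    (hcop : IsCoprime n n') :
    kolyvaginClass W n hdiv hA (j (kolyvaginPoint σ L f y)) hP ∈
      selmerLocalKer W (v.adicCompletion K) n :=
  kolyvaginClass_kolyvaginPoint_mem_selmerLocalKer_of_GZ31 W hf hgen hord hdvd π j hj hA hP v hI B
    hGZ31 hcop fun c hcB hcI ↦
      oneCocycleClass_eq_zero_of_hasMultiplicativeReductionAt W hw hmult h𝔐 hι hC B hB c hcB hcI

end Summit.BirchSwinnertonDyer.Rank1Residual.X11b.Three.UnramifiedNode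

end
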